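import Mathlib
import HarnessLib
import Summits.ValiantsHypothesis.ValiantsHypothesis.Theses.MonotoneRestoration
import Summits.ValiantsHypothesis.ValiantsHypothesis.Theorems.MonotoneRestorationOrbitRestorationQPNarrowExpressions
import Summits.ValiantsHypothesis.ValiantsHypothesis.Theorems.MonotoneRestorationOrbitRestorationQPHomPolyClose
import Summits.ValiantsHypothesis.ValiantsHypothesis.Theorems.MonotoneRestorationOrbitCompressionQPDiCompressionFloors
import Summits.ValiantsHypothesis.ValiantsHypothesis.Theorems.MonotoneRestorationOrbitCompressionQPDiCharacterisation

/-!
# Route MonotoneRestoration — aside `OrbitRestorationLinearVolumeQP` (stmt-ValiantsHypothesis-18294):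
# THE CURRENCY LADDER OF THE OPEN STUB — bipartite narrow span ⟹ one-sorted narrow expression ⟺ crux

Companion of `Theorems/…LinearVolumeQPDiNarrowTight.lean` (`orbitRestorationLinearVolumeQP_iff_lvDiNarrow`:
R1 ⟺ every `VP` family of the linear-volume class is eventually the closed polynomial of a ONE-SORTED labelled
pattern expression with quasi-polynomially many label assignments).  Here the registered stub's currency is placed
ABOVE that exact currency, family by family and with no `VP` hypothesis:

* `diNarrow_of_mem_narrowSpan` — if every `f n` lies in the `ℂ`-span of the homomorphism polynomials of
  BIPARTITE patterns of treewidth `≤ (log₂ n + c)^c` (the conclusion of `stub_lvNarrowSpan`), then from level `1`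
  on `f n` is the closed polynomial of a one-sorted labelled pattern expression with `k` labels,
  `n^k ≤ 2^{(log₂ n + c + 5)^{c+5}}` (K2 `stub_homPoly_close` + linearity of `close` give one bipartite
  expression with `(log₂ n + c + 2)^{c+2}` labels a side, `narrowExpression_of_mem_narrowSpan`; a bipartite
  expression is a one-sorted expression with the labels added up, `CompressionFloors.exists_diClose_eq_close`);
* `lvDiNarrow_of_lvNarrowSpanConclusion` — hence the registered stub `LvNarrowSpan` (bipartite span for
  `VP ∩ LV`) implies the tight one-sorted statement `LvDiNarrow` of `…DiNarrowTight`, and so R1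
  (`orbitRestorationLinearVolumeQP_of_lvNarrowSpanConclusion`, a second proof of
  `OrbitRestorationLinearVolumeQPNarrow.orbitRestorationLinearVolumeQP_of_lvNarrowSpan` through the one-sorted
  characterisation).

So the ladder reads `LvNarrowSpan ⟹ LvDiNarrow ⟺ R1`; the converse of the first arrow is the two-sorted DESCENT
question (is a matrix-symmetric polynomial with a narrow ONE-SORTED expression narrow BIPARTITELY, with
polylogarithmic loss?), open — the Reynolds projection onto matrix-symmetric polynomials folds one-sorted patterns
into bipartite QUOTIENTS of their double covers, and quotients raise treewidth
(`Theorems/…OrbitCompressionQPTwoSortedPassage.lean` transfers only a VERTEX budget).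

Def-free helper (`--supports stmt-ValiantsHypothesis-18294`); nothing here is a named fact; the stub, R1 and
VP ≠ VNP are NOT moved.

References: Dwivedi–Pago–Seppelt 2026 (arXiv:2601.09343) Outlook Q3; Dawar–Pago–Seppelt 2025 (arXiv:2502.06740)
§5, Remark p. 17, §7.
-/

noncomputable section

open scoped Classical

-- `Summit.ValiantsHypothesis.ValiantsHypothesis.…` is the tree's single-conjunct layout (Sub = Summit).
set_option linter.dupNamespace false

namespace Summit.ValiantsHypothesis.ValiantsHypothesis.Theorems.OrbitRestorationLinearVolumeQPDiNarrow

open Literature.Computability.AlgebraicComplexity MvPolynomial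
open Summit.ValiantsHypothesis.ValiantsHypothesis.Theorems
open Summit.ValiantsHypothesis.ValiantsHypothesis.Theorems.OrbitRestorationQPHomPolyClose

/-- Arithmetic of the label budget: `n^(K + K) ≤ 2^((log₂ n + c + 5)^(c+5))` for
`K = (log₂ n + c + 2)^(c+2)`. [folklore] -/
theorem pow_twice_polylog_le_qp (n c : ℕ) :
    n ^ ((Nat.log 2 n + (c + 2)) ^ (c + 2) + (Nat.log 2 n + (c + 2)) ^ (c + 2)) ≤
      2 ^ ((Nat.log 2 n + (c + 5)) ^ (c + 5)) := by
  have h := narrowExpansion_orbit_bound n (c + 2)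
  refine le_trans ?_ h
  calc n ^ ((Nat.log 2 n + (c + 2)) ^ (c + 2) + (Nat.log 2 n + (c + 2)) ^ (c + 2))
      ≤ (n + 1) ^ ((Nat.log 2 n + (c + 2)) ^ (c + 2) + (Nat.log 2 n + (c + 2)) ^ (c + 2)) :=
        Nat.pow_le_pow_left (Nat.le_succ n) _
    _ ≤ (n + 1) ^ ((Nat.log 2 n + (c + 2)) ^ (c + 2) + 1 + ((Nat.log 2 n + (c + 2)) ^ (c + 2) + 1) + 2) :=
        Nat.pow_le_pow_right (Nat.succ_pos n) (by omega)

/-- **Bipartite narrow span ⟹ one-sorted narrow expression** (family by family, no `VP`): if every `f n`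
lies in the span of the homomorphism polynomials of bipartite patterns of treewidth `≤ (log₂ n + c)^c`, then for
every `n ≥ 1`, `f n` is the closed polynomial of a one-sorted labelled pattern expression with `k` labels,
`n^k ≤ 2^{(log₂ n + c + 5)^{c+5}}`. [folklore] -/
theorem diNarrow_of_mem_narrowSpan (f : (n : ℕ) → MvPolynomial (Fin n × Fin n) ℂ) (c : ℕ)
    (h : ∀ n : ℕ, f n ∈ Submodule.span ℂ
      {p : MvPolynomial (Fin n × Fin n) ℂ | ∃ (a b : ℕ) (E : Multiset (Fin a × Fin b)),
        Literature.Combinatorics.SimpleGraph.treewidth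
            (SimpleGraph.fromRel fun u v : Fin a ⊕ Fin b =>
              ∃ e ∈ E, u = Sum.inl e.1 ∧ v = Sum.inr e.2) ≤ (Nat.log 2 n + c) ^ c ∧
          p = homPoly E n ℂ}) :
    ∀ n : ℕ, 1 ≤ n → ∃ (k : ℕ) (e : DiPatternExpr ℂ k),
      n ^ k ≤ 2 ^ ((Nat.log 2 n + (c + 5)) ^ (c + 5)) ∧ e.close n = f n := by
  intro n hn
  obtain ⟨e, he⟩ := narrowExpression_of_mem_narrowSpan stub_homPoly_close n c hn (f n) (h n)
  obtain ⟨e', -, he'⟩ := CompressionFloors.exists_diClose_eq_close n e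
  exact ⟨_, e', pow_twice_polylog_le_qp n c, he'.trans he⟩

/-- **The registered stub implies the tight one-sorted statement**: if every `VP` family of the linear-volume
class lies level by level in the bipartite polylog-treewidth span (the conclusion of `stub_lvNarrowSpan` of line
`birth`), then every such family is, from level `1` on, the closed polynomial of a one-sorted labelled pattern
expression with quasi-polynomially many label assignments (the statement `LvDiNarrow` of `…DiNarrowTight`,
with `n₀ = 1`). [folklore] -/
theorem lvDiNarrow_of_lvNarrowSpanConclusion
    (h : ∀ f : (n : ℕ) → MvPolynomial (Fin n × Fin n) ℂ, IsVPFamily f →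
      (∃ (c : ℕ) (m : ℕ → ℕ) (a b : (n : ℕ) → Fin (m n) → ℕ)
          (E : (n : ℕ) → (i : Fin (m n)) → Multiset (Fin (a n i) × Fin (b n i)))
          (α : (n : ℕ) → Fin (m n) → ℂ),
        (∀ n, m n ≤ (n + 2) ^ c) ∧ (∀ n i, a n i + b n i ≤ c * (n + 1)) ∧
          ∀ n, f n = ∑ i : Fin (m n), C (α n i) * homPoly (E n i) n ℂ) →
      ∃ c : ℕ, ∀ n : ℕ, f n ∈ Submodule.span ℂ
        {p : MvPolynomial (Fin n × Fin n) ℂ | ∃ (a b : ℕ) (E : Multiset (Fin a × Fin b)),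
          Literature.Combinatorics.SimpleGraph.treewidth
              (SimpleGraph.fromRel fun u v : Fin a ⊕ Fin b =>
                ∃ e ∈ E, u = Sum.inl e.1 ∧ v = Sum.inr e.2) ≤ (Nat.log 2 n + c) ^ c ∧
            p = homPoly E n ℂ})
    (f : (n : ℕ) → MvPolynomial (Fin n × Fin n) ℂ) (hVP : IsVPFamily f)
    (hLV : ∃ (c : ℕ) (m : ℕ → ℕ) (a b : (n : ℕ) → Fin (m n) → ℕ)
        (E : (n : ℕ) → (i : Fin (m n)) → Multiset (Fin (a n i) × Fin (b n i)))
        (α : (n : ℕ) → Fin (m n) → ℂ),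
      (∀ n, m n ≤ (n + 2) ^ c) ∧ (∀ n i, a n i + b n i ≤ c * (n + 1)) ∧
        ∀ n, f n = ∑ i : Fin (m n), C (α n i) * homPoly (E n i) n ℂ) :
    ∃ c n₀ : ℕ, ∀ n : ℕ, n₀ ≤ n → ∃ (k : ℕ) (e : DiPatternExpr ℂ k),
      n ^ k ≤ 2 ^ ((Nat.log 2 n + c) ^ c) ∧ e.close n = f n := by
  obtain ⟨c, hc⟩ := h f hVP hLV
  exact ⟨c + 5, 1, diNarrow_of_mem_narrowSpan f c hc⟩

/-- **R1 from the registered stub, through the one-sorted characterisation** (a second proof of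
`OrbitRestorationLinearVolumeQPNarrow.orbitRestorationLinearVolumeQP_of_lvNarrowSpan`: bipartite narrow span ⟹
one-sorted narrow expression ⟹ qp-orbit square-symmetric circuits). [folklore] -/
theorem orbitRestorationLinearVolumeQP_of_lvNarrowSpanConclusion
    (h : ∀ f : (n : ℕ) → MvPolynomial (Fin n × Fin n) ℂ, IsVPFamily f →
      (∃ (c : ℕ) (m : ℕ → ℕ) (a b : (n : ℕ) → Fin (m n) → ℕ)
          (E : (n : ℕ) → (i : Fin (m n)) → Multiset (Fin (a n i) × Fin (b n i)))
          (α : (n : ℕ) → Fin (m n) → ℂ),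
        (∀ n, m n ≤ (n + 2) ^ c) ∧ (∀ n i, a n i + b n i ≤ c * (n + 1)) ∧
          ∀ n, f n = ∑ i : Fin (m n), C (α n i) * homPoly (E n i) n ℂ) →
      ∃ c : ℕ, ∀ n : ℕ, f n ∈ Submodule.span ℂ
        {p : MvPolynomial (Fin n × Fin n) ℂ | ∃ (a b : ℕ) (E : Multiset (Fin a × Fin b)),
          Literature.Combinatorics.SimpleGraph.treewidth
              (SimpleGraph.fromRel fun u v : Fin a ⊕ Fin b =>
                ∃ e ∈ E, u = Sum.inl e.1 ∧ v = Sum.inr e.2) ≤ (Nat.log 2 n + c) ^ c ∧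
            p = homPoly E n ℂ}) :
    Summit.ValiantsHypothesis.ValiantsHypothesis.Theses.MonotoneRestoration.OrbitRestorationLinearVolumeQP := by
  intro f hVP hLV
  refine (OrbitSupport.qpOrbitFamily_iff_diNarrow f).2 ⟨fun n σ => ?_, lvDiNarrow_of_lvNarrowSpanConclusion h f hVP hLV⟩
  -- square symmetry of the class is automatic (hom combinations are even matrix-symmetric)
  obtain ⟨c, m, a, b, E, α, -, -, hf⟩ := hLV
  rw [hf n]
  show rename (fun p : Fin n × Fin n => σ • p) _ = _
  have hfun : (fun p : Fin n × Fin n => σ • p) = fun p : Fin n × Fin n => (σ p.1, σ p.2) := by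
    funext p; rfl
  rw [hfun, map_sum]
  refine Finset.sum_congr rfl fun i _ => ?_
  rw [map_mul, rename_C, rename_perm_homPoly]

/-! ### Appendix: at the SPAN level, a bipartite pattern is a one-sorted pattern of the same treewidth -/

/-- **Bipartite homomorphism polynomials are one-sorted homomorphism polynomials** (span-level twin of
`CompressionFloors.exists_diClose_eq_close`): orient every edge of the bipartite pattern `E` on `Fin a ⊔ Fin b`
from its row end to its column end; the directed pattern on the vertex type `Fin a ⊕ Fin b` so obtained (no loops,
no through-vertices, the same underlying graph, hence the same treewidth) has `dihom = hom_E` — summing over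
`h : Fin a ⊕ Fin b → Fin n` is summing over the pairs `(h ∘ inl, h ∘ inr)`.  So the bipartite narrow span sits
inside the one-sorted narrow span with NO loss; DESCENT (the converse for matrix-symmetric polynomials) is the
only open direction. [folklore] -/
theorem diHomPoly_orient_eq_homPoly {a b : ℕ} (E : Multiset (Fin a × Fin b)) (n : ℕ) :
    diHomPoly (E.map fun e => ((Sum.inl e.1 : Fin a ⊕ Fin b), (Sum.inr e.2 : Fin a ⊕ Fin b))) n ℂ =
      homPoly E n ℂ := by
  unfold diHomPoly homPoly
  refine Fintype.sum_equiv (Equiv.sumArrowEquivProdArrow (Fin a) (Fin b) (Fin n)) _ _ fun h => ?_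
  simp only [Multiset.map_map, Function.comp_def, Equiv.sumArrowEquivProdArrow_apply_fst,
    Equiv.sumArrowEquivProdArrow_apply_snd]

/-- Hence every member of a bipartite narrow span is a member of the one-sorted span over directed patterns
with the same treewidth bound (here stated for a single generator: `hom_E` is the `dihom` of a directed pattern
on `Fin a ⊕ Fin b` whose edges all go from `inl`-vertices to `inr`-vertices). [folklore] -/
theorem exists_diHomPoly_eq_homPoly {a b : ℕ} (E : Multiset (Fin a × Fin b)) (n : ℕ) :
    ∃ D : Multiset ((Fin a ⊕ Fin b) × (Fin a ⊕ Fin b)),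
      (∀ d ∈ D, ∃ e ∈ E, d = (Sum.inl e.1, Sum.inr e.2)) ∧ diHomPoly D n ℂ = homPoly E n ℂ :=
  ⟨E.map fun e => (Sum.inl e.1, Sum.inr e.2), fun d hd => by
    obtain ⟨e, he, rfl⟩ := Multiset.mem_map.1 hd
    exact ⟨e, he, rfl⟩, diHomPoly_orient_eq_homPoly E n⟩

end Summit.ValiantsHypothesis.ValiantsHypothesis.Theorems.OrbitRestorationLinearVolumeQPDiNarrow

end
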